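import Mathlib
import HarnessLib
import Literature.MathematicalPhysics.AQFT.OSAxiomsSchwinger
import Literature.MathematicalPhysics.AQFT.OffDiagonalFlatDecay
import Literature.MathematicalPhysics.QuantumLattice.SchwingerOSAxioms
import Summits.QuantumFields.YangMills.Theorems.PencilRigidityNPointIsotropyOffDiagCutoff
import Summits.QuantumFields.YangMills.Theorems.PencilRigidityNPointIsotropyOffDiagCutoffTendsto

/-!
# `CoincidenceRotationBootstrap.HypercubicLimit`, line `Sketch` (coupling response): flat dyadic shells

Stub `flatShellDecomposition` (step Z1a, piece D) of crux `stmt-QuantumFields-16154`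
(`Summit.QuantumFields.YangMills.Theses.CoincidenceRotationBootstrap.HypercubicLimit`), line `Sketch`.

Informal statement. Let `F ∈ ⁰𝒮((ℝ⁴)ⁿ)` be a Schwartz `n`-point test function flat on the coincidence
locus (`IsOffDiagonal F`), compactly supported, and supported at pairwise distances `≥ δ > 0`. Then
`F = Σ_{j<J} u_j` with compactly supported Schwartz functions `u_j` supported at pairwise distances
`≥ 2^{-(j+1)}` and `|u_j|_{t'} ≤ C 2^{-N j} |F|_{t''}` for every prescribed order `t'` and decay rate `N`,
with `C, t''` depending on `n, t', N` only (`t'' = 2 t' + N + 1`).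

Proof. Let `ψ_k` be the off-diagonal cut-off family (`offDiagCutoffFamily`: `ψ_k = 1` where all pairwise
distances are `≥ 2/(k+1)`, `ψ_k = 0` where some distance is `≤ 1/(k+1)`, `‖D^l ψ_k‖ ≤ C_l (k+1)^l`) and
`η_j = ψ_{2^{j+1}-1}` its dyadic subfamily. The shells are `u_0 = η_0 F`, `u_j = (η_j - η_{j-1}) F`;
they telescope to `η_{J-1} F = F` once `2^{-(J-1)} ≤ δ`, `u_j` vanishes near every point with a pair at
distance `< 2^{-(j+1)}`, and for `j ≥ 1` the cut-off `η_j - η_{j-1}` is supported where some pair is at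
distance `≤ 2^{1-j} ≤ 1`. There `F` is flat: merging the close pair gives a coincident point `z` with
`‖x - z‖ ≤ 2^{1-j}`, and Taylor's formula (`one_add_pow_mul_norm_iteratedFDeriv_le`) gives
`(1 + ‖x‖)^k ‖D^m F(x)‖ ≤ 4^k |F|_{t''} 2^{(1-j)(N+l+1)}` for `m ≤ l`; by Leibniz and
`‖D^c(η_j - η_{j-1})‖ ≤ 2 C_c 2^{(j+1)c}` every Schwartz seminorm of order `≤ t'` of `u_j` is
`≤ C' 2^{(j+1) l} 2^{(1-j)(N+l+1)} |F|_{t''} ≤ C 2^{-N j} |F|_{t''}`. References: folklore (dyadic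
Whitney-type decomposition near a closed set; L. Hörmander, The Analysis of Linear Partial Differential
Operators I (1990), §1.4 and Lemma 7.1.8; K. Osterwalder, R. Schrader, Comm. Math. Phys. 42 (1975) §2,
the norms `|·|_m` on `⁰𝒮`). [folklore]
-/

noncomputable section

open scoped SchwartzMap ContDiff
open MeasureTheory Filter Topology Literature.MathematicalPhysics.AQFT Literature.MathematicalPhysics.QuantumLattice
open Summit.QuantumFields.YangMills.Theorems.NPointIsotropy.ComplexRotationBandlimit

namespace Summit.QuantumFields.YangMills.Cruxes.HypercubicLimit.CouplingResponse

/-! ## Dyadic shell cut-offs -/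

/-- **Dyadic shell cut-offs.** From the off-diagonal cut-off family `ψ_k` (`offDiagCutoffFamily`) put
`η_j = ψ_{2^{j+1}-1}` and `W_0 = η_0`, `W_{j+1} = η_{j+1} - η_j`. Then `W_j` is smooth with
`‖D^l W_j‖ ≤ A_l 2^{(j+1) l}`, `W_j(x) = 0` as soon as some pair of `x` is at distance `< 2^{-(j+1)}`,
`W_{j+1}(x) = 0` as soon as all pairs are at distance `≥ 2^{-j}`, and `Σ_{j ≤ J} W_j(x) = η_J(x) = 1` when
all pairs are at distance `≥ 2^{-J}` (telescoping). [folklore] -/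
theorem exists_dyadicShellCutoffs (n : ℕ) :
    ∃ (A : ℕ → ℝ) (W : ℕ → (Fin n → EuclideanSpace ℝ (Fin 4)) → ℝ), (∀ l, 0 ≤ A l) ∧
      (∀ j, ContDiff ℝ ∞ (W j)) ∧
      (∀ j l x, ‖iteratedFDeriv ℝ l (W j) x‖ ≤ A l * 2 ^ ((j + 1) * l)) ∧
      (∀ j x, (∃ i i' : Fin n, i ≠ i' ∧ ‖x i - x i'‖ < (2 : ℝ)⁻¹ ^ (j + 1)) → W j x = 0) ∧
      (∀ j x, (∀ i i' : Fin n, i ≠ i' → (2 : ℝ)⁻¹ ^ j ≤ ‖x i - x i'‖) → W (j + 1) x = 0) ∧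
      (∀ J x, (∀ i i' : Fin n, i ≠ i' → (2 : ℝ)⁻¹ ^ J ≤ ‖x i - x i'‖) →
        ∑ j ∈ Finset.range (J + 1), W j x = 1) := by
  obtain ⟨C, ψ, hψs, -, hψ1, hψ0, hψC⟩ := offDiagCutoffFamily n
  have hC0 : ∀ l, 0 ≤ C l := fun l => by
    have h := hψC 0 l 0
    rw [Nat.cast_zero, zero_add, one_pow, mul_one] at h
    exact (norm_nonneg _).trans h
  -- the dyadic subfamily `η j = ψ (2^(j+1) - 1)`, of scale parameter `k + 1 = 2^(j+1)`
  have hd : ∀ j : ℕ, ((2 ^ (j + 1) - 1 : ℕ) : ℝ) + 1 = 2 ^ (j + 1) := fun j => by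
    rw [Nat.cast_sub Nat.one_le_two_pow]; push_cast; ring
  have h2j : ∀ j : ℕ, (2 : ℝ) / 2 ^ (j + 1) = 2⁻¹ ^ j := fun j => by
    rw [inv_pow, pow_succ]; field_simp
  have h1j : ∀ j : ℕ, (1 : ℝ) / 2 ^ (j + 1) = 2⁻¹ ^ (j + 1) := fun j => by rw [one_div, inv_pow]
  have hhalf : ∀ j : ℕ, (2 : ℝ)⁻¹ ^ (j + 1) ≤ 2⁻¹ ^ j := fun j =>
    pow_le_pow_of_le_one (by norm_num) (by norm_num) (Nat.le_succ j)
  obtain ⟨η, hη⟩ : ∃ η : ℕ → (Fin n → EuclideanSpace ℝ (Fin 4)) → ℝ,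
      ∀ j, η j = ψ (2 ^ (j + 1) - 1) := ⟨_, fun _ => rfl⟩
  have hηs : ∀ j, ContDiff ℝ ∞ (η j) := fun j => by rw [hη]; exact hψs _
  have hη1 : ∀ j x, (∀ i i' : Fin n, i ≠ i' → (2 : ℝ)⁻¹ ^ j ≤ ‖x i - x i'‖) → η j x = 1 := by
    intro j x hx
    rw [hη]
    refine hψ1 _ x fun i i' hii' => ?_
    rw [hd, h2j]
    exact hx i i' hii'
  have hη0 : ∀ j x, (∃ i i' : Fin n, i ≠ i' ∧ ‖x i - x i'‖ ≤ (2 : ℝ)⁻¹ ^ (j + 1)) → η j x = 0 := by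
    rintro j x ⟨i, i', hii', hle⟩
    rw [hη]
    refine hψ0 _ x ⟨i, i', hii', ?_⟩
    rwa [hd, h1j]
  have hηC : ∀ j l x, ‖iteratedFDeriv ℝ l (η j) x‖ ≤ C l * 2 ^ ((j + 1) * l) := by
    intro j l x
    have h := hψC (2 ^ (j + 1) - 1) l x
    rwa [hd, ← pow_mul, ← hη] at h
  -- `ηm j = η (j - 1)` with `ηm 0 = 0`
  obtain ⟨ηm, hηm0, hηmS⟩ : ∃ ηm : ℕ → (Fin n → EuclideanSpace ℝ (Fin 4)) → ℝ,
      ηm 0 = 0 ∧ ∀ j, ηm (j + 1) = η j :=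
    ⟨fun j => match j with | 0 => 0 | i + 1 => η i, rfl, fun _ => rfl⟩
  have hηms : ∀ j, ContDiff ℝ ∞ (ηm j) := by
    rintro (_ | j)
    · rw [hηm0]; exact contDiff_const
    · rw [hηmS]; exact hηs j
  have hηmC : ∀ j l x, ‖iteratedFDeriv ℝ l (ηm j) x‖ ≤ C l * 2 ^ ((j + 1) * l) := by
    rintro (_ | j) l x
    · rw [hηm0, iteratedFDeriv_zero, Pi.zero_apply, norm_zero]
      exact mul_nonneg (hC0 l) (by positivity)
    · rw [hηmS]
      refine (hηC j l x).trans (mul_le_mul_of_nonneg_left (pow_le_pow_right₀ one_le_two ?_) (hC0 l))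
      exact Nat.mul_le_mul_right l (Nat.le_succ _)
  obtain ⟨W, hW⟩ : ∃ W : ℕ → (Fin n → EuclideanSpace ℝ (Fin 4)) → ℝ, ∀ j, W j = η j - ηm j :=
    ⟨_, fun _ => rfl⟩
  have htel : ∀ (J : ℕ) x, ∑ j ∈ Finset.range J, W j x = ηm J x := by
    intro J x
    induction J with
    | zero => simp [hηm0]
    | succ J ih => rw [Finset.sum_range_succ, ih, hηmS, hW, Pi.sub_apply]; ring
  refine ⟨fun l => 2 * C l, W, fun l => mul_nonneg zero_le_two (hC0 l),
    fun j => by rw [hW]; exact (hηs j).sub (hηms j), fun j l x => ?_, fun j x hx => ?_,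
    fun j x hx => ?_, fun J x hx => ?_⟩
  · rw [hW, iteratedFDeriv_sub_apply ((hηs j).of_le (mod_cast le_top)).contDiffAt
      ((hηms j).of_le (mod_cast le_top)).contDiffAt]
    calc ‖iteratedFDeriv ℝ l (η j) x - iteratedFDeriv ℝ l (ηm j) x‖
        ≤ ‖iteratedFDeriv ℝ l (η j) x‖ + ‖iteratedFDeriv ℝ l (ηm j) x‖ := norm_sub_le _ _
      _ ≤ C l * 2 ^ ((j + 1) * l) + C l * 2 ^ ((j + 1) * l) := add_le_add (hηC j l x) (hηmC j l x)
      _ = 2 * C l * 2 ^ ((j + 1) * l) := by ring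
  · obtain ⟨i, i', hii', hlt⟩ := hx
    rw [hW, Pi.sub_apply, hη0 j x ⟨i, i', hii', hlt.le⟩]
    rcases j with _ | j
    · rw [hηm0, Pi.zero_apply, sub_zero]
    · rw [hηmS, hη0 j x ⟨i, i', hii', hlt.le.trans (hhalf (j + 1))⟩, sub_zero]
  · rw [hW, Pi.sub_apply, hηmS, hη1 j x hx,
      hη1 (j + 1) x fun i i' hii' => (hhalf j).trans (hx i i' hii'), sub_self]
  · rw [htel, hηmS]
    exact hη1 J x hx

/-! ## Pointwise estimates -/

/-- Pointwise Leibniz bound: if `‖D^c W(x)‖ ≤ A` for `c ≤ b` and `‖x‖^a ‖D^m F(x)‖ ≤ B` for `m ≤ b`, then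
`‖x‖^a ‖D^b(W F)(x)‖ ≤ 2^b A B` (`Σ_c (b choose c) = 2^b`). [folklore] -/
theorem pow_mul_norm_iteratedFDeriv_smul_le_of_le {X : Type*} [NormedAddCommGroup X] [NormedSpace ℝ X]
    {W : X → ℝ} (hW : ContDiff ℝ ∞ W) (F : 𝓢(X, ℂ)) {a b : ℕ} {A B : ℝ} (hA0 : 0 ≤ A) (x : X)
    (hA : ∀ c ≤ b, ‖iteratedFDeriv ℝ c W x‖ ≤ A)
    (hB : ∀ m ≤ b, ‖x‖ ^ a * ‖iteratedFDeriv ℝ m F x‖ ≤ B) :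
    ‖x‖ ^ a * ‖iteratedFDeriv ℝ b (fun y => W y • F y) x‖ ≤ 2 ^ b * A * B := by
  have hleib := norm_iteratedFDeriv_smul_le (𝕜 := ℝ) hW (F.smooth ⊤) x (n := b) (mod_cast le_top)
  have hB0 : 0 ≤ B := le_trans (by positivity) (hB 0 (Nat.zero_le _))
  calc ‖x‖ ^ a * ‖iteratedFDeriv ℝ b (fun y => W y • F y) x‖
      ≤ ‖x‖ ^ a * ∑ c ∈ Finset.range (b + 1),
          (b.choose c : ℝ) * ‖iteratedFDeriv ℝ c W x‖ * ‖iteratedFDeriv ℝ (b - c) F x‖ := by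
        gcongr
    _ = ∑ c ∈ Finset.range (b + 1),
          (b.choose c : ℝ) * ‖iteratedFDeriv ℝ c W x‖ * (‖x‖ ^ a * ‖iteratedFDeriv ℝ (b - c) F x‖) := by
        rw [Finset.mul_sum]
        exact Finset.sum_congr rfl fun c _ => by ring
    _ ≤ ∑ c ∈ Finset.range (b + 1), (b.choose c : ℝ) * A * B := by
        refine Finset.sum_le_sum fun c hc => ?_
        have hcb : c ≤ b := Nat.lt_succ_iff.mp (Finset.mem_range.mp hc)
        exact mul_le_mul (mul_le_mul_of_nonneg_left (hA c hcb) (Nat.cast_nonneg _))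
          (hB (b - c) (Nat.sub_le b c)) (by positivity) (by positivity)
    _ = 2 ^ b * A * B := by
        rw [← Finset.sum_mul, ← Finset.sum_mul]
        congr 2
        rw [← Nat.cast_sum, Nat.sum_range_choose]
        norm_num

/-- Weighted flatness of the derivatives of a `⁰𝒮` function at a point with a close pair, in the
currency of `schwartzNorm`: if `‖x_i - x_{i'}‖ ≤ ρ ≤ 1` (`i ≠ i'`) and `m + (M + 1) ≤ p`, `k ≤ p`, then
`‖x‖^k ‖D^m F(x)‖ ≤ 4^k |F|_p ρ^{M+1}` (merge the pair: `one_add_pow_mul_norm_iteratedFDeriv_le`). [folklore] -/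
theorem pow_mul_norm_iteratedFDeriv_le_of_pair {n : ℕ} {F : 𝓢((Fin n → EuclideanSpace ℝ (Fin 4)), ℂ)}
    (hF : IsOffDiagonal F) {x : Fin n → EuclideanSpace ℝ (Fin 4)} {i i' : Fin n} (hii' : i ≠ i')
    {ρ : ℝ} (hρ : ‖x i - x i'‖ ≤ ρ) (hρ1 : ρ ≤ 1) (k : ℕ) {m M p : ℕ} (hp : m + (M + 1) ≤ p)
    (hk : k ≤ p) :
    ‖x‖ ^ k * ‖iteratedFDeriv ℝ m F x‖ ≤ 4 ^ k * schwartzNorm p F * ρ ^ (M + 1) := by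
  have hz := update_mem_coincidenceLocus (E := EuclideanSpace ℝ (Fin 4)) hii' x
  have hxz : ‖x - Function.update x i' (x i)‖ = ‖x i - x i'‖ := by
    rw [norm_sub_update_eq, norm_sub_rev]
  calc ‖x‖ ^ k * ‖iteratedFDeriv ℝ m F x‖ ≤ (1 + ‖x‖) ^ k * ‖iteratedFDeriv ℝ m F x‖ := by
        gcongr; exact le_add_of_nonneg_left zero_le_one
    _ ≤ 4 ^ k * (Finset.Iic (k, p)).sup
          (schwartzSeminormFamily ℂ (Fin n → EuclideanSpace ℝ (Fin 4)) ℂ) F *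
          ‖x - Function.update x i' (x i)‖ ^ (M + 1) :=
        one_add_pow_mul_norm_iteratedFDeriv_le hF hz (by rw [hxz]; exact hρ.trans hρ1) k hp
    _ ≤ 4 ^ k * schwartzNorm p F * ρ ^ (M + 1) := by
        rw [hxz]
        exact mul_le_mul (mul_le_mul_of_nonneg_left (sup_seminorm_le_schwartzNorm hk le_rfl F)
          (by positivity)) (pow_le_pow_left₀ (norm_nonneg _) hρ _) (by positivity)
          (mul_nonneg (by positivity) (schwartzNorm_nonneg _ _))

/-- Dyadic bookkeeping: `2^P 2^{-Q} ≤ 2^R 2^{-S}` as soon as `P + S ≤ R + Q`. [folklore] -/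
theorem two_pow_mul_inv_two_pow_le {P Q R S : ℕ} (h : P + S ≤ R + Q) :
    (2 : ℝ) ^ P * 2⁻¹ ^ Q ≤ 2 ^ R * 2⁻¹ ^ S := by
  rw [inv_pow, inv_pow, ← div_eq_mul_inv, ← div_eq_mul_inv,
    div_le_div_iff₀ (by positivity) (by positivity), ← pow_add, ← pow_add]
  exact pow_le_pow_right₀ one_le_two h

/-- A Schwartz norm of order `m` is bounded by any common bound of the pointwise quantities
`‖x‖^k ‖D^l u(x)‖`, `k, l ≤ m` (`SchwartzMap.seminorm_le_bound` on each seminorm of the finite sup).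
[folklore] -/
theorem schwartzNorm_le_of_pointwise {X : Type*} [NormedAddCommGroup X] [NormedSpace ℝ X] {m : ℕ}
    (u : 𝓢(X, ℂ)) {B : ℝ} (hB : 0 ≤ B)
    (h : ∀ k l, k ≤ m → l ≤ m → ∀ x, ‖x‖ ^ k * ‖iteratedFDeriv ℝ l u x‖ ≤ B) :
    schwartzNorm m u ≤ B := by
  change ((Finset.Iic (m, m)).sup (schwartzSeminormFamily ℂ X ℂ)) u ≤ B
  refine Seminorm.finset_sup_apply_le hB fun q hq => ?_
  rw [Finset.mem_Iic] at hq
  rw [SchwartzMap.schwartzSeminormFamily_apply]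
  exact SchwartzMap.seminorm_le_bound ℂ q.1 q.2 u hB (h q.1 q.2 hq.1 hq.2)

/-! ## The decomposition -/

/-- **Stub `flatShellDecomposition` (Z1a, piece D): flat dyadic shells.** A compactly supported
`F ∈ ⁰𝒮((ℝ⁴)ⁿ)` supported at pairwise distances `≥ δ > 0` decomposes as `F = Σ_{j<J} u_j` with compactly
supported Schwartz `u_j` supported at pairwise distances `≥ 2^{-(j+1)}` and
`|u_j|_{t'} ≤ C 2^{-N j} |F|_{2t'+N+1}`, `C = C(n, t', N)`: the shells `u_j = W_j F` of the dyadic cut-offs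
(`exists_dyadicShellCutoffs`), Leibniz, and the flatness of `F` at the coincidence locus on the support of
`W_j` (`j ≥ 1`), where some pair is at distance `≤ 2^{1-j}`. [folklore] -/
theorem flatShellDecomposition : ∀ n : ℕ, ∀ t' N : ℕ, ∃ (C : ℝ) (t'' : ℕ), 0 ≤ C ∧ ∀ F : 𝓢((Fin n → EuclideanSpace ℝ (Fin 4)), ℂ), IsOffDiagonal F → HasCompactSupport (F : (Fin n → EuclideanSpace ℝ (Fin 4)) → ℂ) → (∃ δ : ℝ, 0 < δ ∧ ∀ x ∈ tsupport (F : (Fin n → EuclideanSpace ℝ (Fin 4)) → ℂ), ∀ i j, i ≠ j → δ ≤ ‖x i - x j‖) → ∃ (J : ℕ) (u : ℕ → 𝓢((Fin n → EuclideanSpace ℝ (Fin 4)), ℂ)), F = ∑ j ∈ Finset.range J, u j ∧ ∀ j, HasCompactSupport (u j : (Fin n → EuclideanSpace ℝ (Fin 4)) → ℂ) ∧ (∀ x ∈ tsupport (u j : (Fin n → EuclideanSpace ℝ (Fin 4)) → ℂ), ∀ i i', i ≠ i' → (2 : ℝ)⁻¹ ^ (j + 1) ≤ ‖x i - x i'‖)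 ∧ schwartzNorm t' (u j) ≤ C * (2 : ℝ)⁻¹ ^ (N * j) * schwartzNorm t'' F := by
  intro n t' N
  obtain ⟨A, W, hA0, hWs, hWC, hW0, hW1, hWsum⟩ := exists_dyadicShellCutoffs n
  -- a common bound for the cut-off constants of order `≤ t'`
  obtain ⟨Amax, hAmax0, hAmax⟩ : ∃ Amax : ℝ, 0 ≤ Amax ∧ ∀ l ≤ t', A l ≤ Amax :=
    ⟨∑ l ∈ Finset.range (t' + 1), A l, Finset.sum_nonneg fun l _ => hA0 l, fun l hl =>
      Finset.single_le_sum (fun i _ => hA0 i) (Finset.mem_range.2 (Nat.lt_succ_of_le hl))⟩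
  refine ⟨2 ^ (3 * t' + N) * 4 ^ t' * Amax, 2 * t' + N + 1, by positivity, ?_⟩
  rintro F hF hFc ⟨δ, hδ, hFδ⟩
  have hS0 := schwartzNorm_nonneg (2 * t' + N + 1) F
  -- the shells `u j = W j • F`
  have hsm : ∀ j, ContDiff ℝ ∞ fun y => W j y • F y := fun j => (hWs j).fun_smul (F.smooth ⊤)
  have hcs : ∀ j, HasCompactSupport fun y => W j y • F y := fun j => hFc.smul_left (f := W j)
  obtain ⟨u, hu⟩ : ∃ u : ℕ → 𝓢((Fin n → EuclideanSpace ℝ (Fin 4)), ℂ), ∀ j y, u j y = W j y • F y :=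
    ⟨fun j => (hcs j).toSchwartzMap (hsm j), fun j y => rfl⟩
  have hcoe : ∀ j, ((u j : 𝓢((Fin n → EuclideanSpace ℝ (Fin 4)), ℂ)) :
      (Fin n → EuclideanSpace ℝ (Fin 4)) → ℂ) = fun y => W j y • F y := fun j => funext (hu j)
  -- number of shells: `2⁻¹ ^ J' < δ`
  obtain ⟨J', hJ'⟩ : ∃ J' : ℕ, (2 : ℝ)⁻¹ ^ J' < δ := exists_pow_lt_of_lt_one hδ (by norm_num)
  refine ⟨J' + 1, u, ?_, fun j => ⟨by rw [hcoe]; exact hcs j, ?_, ?_⟩⟩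
  · -- telescoping: `Σ_{j ≤ J'} u j = η_{J'} F = F`
    ext x
    rw [sum_apply]
    simp only [hu, ← Finset.sum_smul]
    by_cases hx : x ∈ tsupport (F : (Fin n → EuclideanSpace ℝ (Fin 4)) → ℂ)
    · rw [hWsum J' x fun i i' hii' => hJ'.le.trans (hFδ x hx i i' hii'), one_smul]
    · rw [image_eq_zero_of_notMem_tsupport hx, smul_zero]
  · -- separation `≥ 2⁻¹ ^ (j+1)` on the support of the `j`-th shell
    intro x hx i i' hii'
    by_contra hlt
    have hopen : IsOpen {y : Fin n → EuclideanSpace ℝ (Fin 4) | ‖y i - y i'‖ < (2 : ℝ)⁻¹ ^ (j + 1)} :=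
      isOpen_lt (by fun_prop) continuous_const
    refine (notMem_tsupport_iff_eventuallyEq.2 ?_) hx
    filter_upwards [hopen.mem_nhds (not_le.mp hlt)] with y hy
    rw [hu, hW0 j y ⟨i, i', hii', hy⟩, zero_smul, Pi.zero_apply]
  · -- the Schwartz-norm bound on the `j`-th shell
    refine schwartzNorm_le_of_pointwise (u j) (by positivity) fun k l hk hl x => ?_
    rw [hcoe j]
    rcases j with _ | j
    · -- `u 0 = η_0 F`: Leibniz with bounded cut-off derivatives, no flatness needed
      have hAc : ∀ c ≤ l, ‖iteratedFDeriv ℝ c (W 0) x‖ ≤ Amax * 2 ^ t' := fun c hc => by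
        refine (hWC 0 c x).trans ?_
        rw [zero_add, one_mul]
        exact mul_le_mul (hAmax c (hc.trans hl)) (pow_le_pow_right₀ one_le_two (hc.trans hl))
          (by positivity) hAmax0
      have hBm : ∀ m ≤ l, ‖x‖ ^ k * ‖iteratedFDeriv ℝ m F x‖ ≤ schwartzNorm (2 * t' + N + 1) F :=
        fun m hm => (SchwartzMap.le_seminorm ℂ k m F x).trans
          (seminorm_le_schwartzNorm (by omega) (by omega) F)
      refine (pow_mul_norm_iteratedFDeriv_smul_le_of_le (hWs 0) F (by positivity) x hAc hBm).trans ?_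
      have h1 : (2 : ℝ) ^ (l + t') ≤ 2 ^ (3 * t' + N) := pow_le_pow_right₀ one_le_two (by omega)
      have h2 : (1 : ℝ) ≤ 4 ^ t' := one_le_pow₀ (by norm_num)
      calc 2 ^ l * (Amax * 2 ^ t') * schwartzNorm (2 * t' + N + 1) F
          = 2 ^ (l + t') * 1 * Amax * schwartzNorm (2 * t' + N + 1) F := by ring
        _ ≤ 2 ^ (3 * t' + N) * 4 ^ t' * Amax * schwartzNorm (2 * t' + N + 1) F := by gcongr
        _ = 2 ^ (3 * t' + N) * 4 ^ t' * Amax * 2⁻¹ ^ (N * 0) * schwartzNorm (2 * t' + N + 1) F := by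
            rw [mul_zero, pow_zero, mul_one]
    · by_cases hx : ∃ i i' : Fin n, i ≠ i' ∧ ‖x i - x i'‖ ≤ (2 : ℝ)⁻¹ ^ j
      · -- near the locus: Leibniz, cut-off bounds `2^{(j+2) c}` and flatness of order `N + l + 1`
        obtain ⟨i, i', hii', hxi⟩ := hx
        have hAc : ∀ c ≤ l, ‖iteratedFDeriv ℝ c (W (j + 1)) x‖ ≤ Amax * 2 ^ ((j + 1 + 1) * l) :=
          fun c hc => (hWC (j + 1) c x).trans (mul_le_mul (hAmax c (hc.trans hl))
            (pow_le_pow_right₀ one_le_two (Nat.mul_le_mul_left _ hc)) (by positivity) hAmax0)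
        have hBm : ∀ m ≤ l, ‖x‖ ^ k * ‖iteratedFDeriv ℝ m F x‖ ≤
            4 ^ k * schwartzNorm (2 * t' + N + 1) F * ((2 : ℝ)⁻¹ ^ j) ^ (N + l + 1) := fun m hm =>
          pow_mul_norm_iteratedFDeriv_le_of_pair hF hii' hxi (pow_le_one₀ (by norm_num) (by norm_num))
            k (m := m) (M := N + l) (p := 2 * t' + N + 1) (by omega) (by omega)
        refine (pow_mul_norm_iteratedFDeriv_smul_le_of_le (hWs (j + 1)) F (by positivity) x hAc
          hBm).trans ?_
        have hexp : l + (j + 1 + 1) * l + N * (j + 1) ≤ 3 * t' + N + j * (N + l + 1) := by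
          nlinarith [hl]
        have hpow : (2 : ℝ) ^ (l + (j + 1 + 1) * l) * 2⁻¹ ^ (j * (N + l + 1)) ≤
            2 ^ (3 * t' + N) * 2⁻¹ ^ (N * (j + 1)) := two_pow_mul_inv_two_pow_le hexp
        have h4 : (4 : ℝ) ^ k ≤ 4 ^ t' := pow_le_pow_right₀ (by norm_num) hk
        calc 2 ^ l * (Amax * 2 ^ ((j + 1 + 1) * l)) *
              (4 ^ k * schwartzNorm (2 * t' + N + 1) F * ((2 : ℝ)⁻¹ ^ j) ^ (N + l + 1))
            = 4 ^ k * Amax * (2 ^ (l + (j + 1 + 1) * l) * 2⁻¹ ^ (j * (N + l + 1))) *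
                schwartzNorm (2 * t' + N + 1) F := by ring
          _ ≤ 4 ^ t' * Amax * (2 ^ (3 * t' + N) * 2⁻¹ ^ (N * (j + 1))) *
                schwartzNorm (2 * t' + N + 1) F := by gcongr
          _ = 2 ^ (3 * t' + N) * 4 ^ t' * Amax * 2⁻¹ ^ (N * (j + 1)) *
                schwartzNorm (2 * t' + N + 1) F := by ring
      · -- away from the locus `W (j+1) = 0` near `x`: the derivative vanishes
        push Not at hx
        have hev : ∀ᶠ y in 𝓝 x, ∀ i i' : Fin n, i ≠ i' → (2 : ℝ)⁻¹ ^ j ≤ ‖y i - y i'‖ := by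
          simp only [eventually_all]
          intro i i' hii'
          have hc : Continuous fun y : Fin n → EuclideanSpace ℝ (Fin 4) => ‖y i - y i'‖ := by fun_prop
          exact ((hc.tendsto x).eventually_const_lt (hx i i' hii')).mono fun _ hy => hy.le
        have h0 : (fun y => W (j + 1) y • F y) =ᶠ[𝓝 x]
            (0 : (Fin n → EuclideanSpace ℝ (Fin 4)) → ℂ) :=
          hev.mono fun y hy => by simp only [hW1 j y hy, zero_smul, Pi.zero_apply]
        rw [(h0.iteratedFDeriv ℝ l).eq_of_nhds, iteratedFDeriv_zero, Pi.zero_apply, norm_zero, mul_zero]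
        positivity

end Summit.QuantumFields.YangMills.Cruxes.HypercubicLimit.CouplingResponse

end
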